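import Summits.QuantumFields.YangMills.Theorems.BalabanUVNodesPortS1QtCDt
import Summits.QuantumFields.YangMills.Theorems.BalabanUVNodesPortS1QtCHopBound

/-!
# Port S1, socket (o1) capstone (o1-ζ) — `D̃` AT THE RECORD ON A k-UNIFORM BALL: (o1-δ) ✓`norm_hopLinGraphC_le` fed into (o1-ε) ✓`exists_recordDt₀`; ONE smallness currency
# (`dist1` of the (0.4) loop variables `≤ α`, `157α < L^{1−d}`), radius `ρ₀(d, L, α)` independent of `k` and of the volume

Cell `ym-nodeO-ideate`, porter seat PT-A-1 (gen 9); `--kind proof --supports stmt-QuantumFields-27930 --as helper`; count-neutral.  [I] = [Balaban1987RG1]; [15] = [Balaban1985Variational].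

WHAT IS PROVED.
* §1 currency conversions: `norm_loopM_sub_one_le_of_dist1` (`dist1 (loopHol Vk c i) = ‖loopM ↑Vk c i − 1‖`), `inv_pow_le_one_T4`, `alpha_le_fiftieth_of_lt` (`157α < L^{1−d} ≤ 1 ⇒ α ≤ 1∕50`),
  `small_of_dist1_le` (the (0.4) guard from `α < 1∕3 ≤ δ₂`).
* §2 ★★★ `exists_recordDt_uniform` — for `k + 1 ≤ m + K` and a background `Vk` whose (0.4) loop variables are within `α` of `1` with `157α < L^{1−d}`: with `θ = L^{1−d} − 157α`, `b = 6∕θ`,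
  `R = 1∕(10⁸dL)`, `C₂ = 2∕R²`, `ρ₀ = min (R∕3) (1∕(18C₂(b+1)))` — `0 < ρ₀` and there is `D̃` on `‖B‖ < ρ₀` valued in the closed ball `4C₂ρ₀²` with `C̃_ℂ(B − h_ℂD̃(B)) = D̃(B)`.  ALL constants depend
  on `d, L, α` only (print: «constants independent of k»).
* §3 ★★ `recordQtC_sub_hop_recordDt_uniform` — the linearisation `Q̃_ℂ(B − h_ℂD̃(B)) = LQ̃_ℂ B` on that ball for every solution `D̃` (✓`recordQtC_sub_hop_recordDt`, the `b₀`-letter by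
  ✓`recordB0BlockInvertible_of_loopSmall`).
SOCKET (o1) OF DEF-1's STAGE 2 IS THEREBY SERVED BY NAME: `recordDt := (exists_recordDt_uniform …).2.choose` is DEF-1's to mint (an object; this file asserts only its existence ∕ uniqueness data).

HONEST FRAMING.  The relation of the `α`-guard to the record's small-field regime `V_ax(W_B)` (which `B` put `Vk` in the guard) is the consumer's ((o4-c) ∕ FE-2), displayed not discharged; nothing of (o3),
`recordFluctInt`, FE-2 is touched; `stub_FE` (XXL) ∕ `stub_P0C` OPEN, ⟨27930⟩ OPEN (1∕3); NODE O 0∕1; COUNT 8∕28 · K 1∕4 UNMOVED; finite `𝕋⁴_{L^K}` at fixed ε — NOT continuum ∕ OS; **the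
Yang–Mills mass gap (Clay) is NOT proved by any of this.**  No `sorry`; standard axioms only.
-/

noncomputable section

open scoped BigOperators Matrix.Norms.L2Operator Topology

open Set Metric Filter

namespace Summit.QuantumFields.YangMills.Theorems.BalabanUVNodesPortS1

open Summit.QuantumFields.YangMills.Theorems.K0RecordFormatNames
open Literature.MathematicalPhysics.QuantumFieldTheory.Balaban1983to89
open Literature.MathematicalPhysics.QuantumFieldTheory.Balaban1983to89.Node00
open Literature.MathematicalPhysics.QuantumFieldTheory.Balaban1983to89.T4Continuum (T4Family)
open Literature.MathematicalPhysics.QuantumFieldTheory.Balaban1983to89.BlockAveraging (avgFun loopHol Small Idx)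
open Literature.MathematicalPhysics.QuantumFieldTheory.Balaban1983to89.ExpMeanLog (expMeanLogSU deltaSU)
open _root_.Matrix

variable (F : T4Family)

/-! ## §1  One smallness currency -/

/-- `dist1 (loopHol Vk c i) ≤ α` read as `‖loopM ↑Vk c i − 1‖ ≤ α` (the (o1-β)∕(o1-ε) hypothesis form). [cite: Balaban1987RG1, (0.4) p.253] -/
theorem norm_loopM_sub_one_le_of_dist1 {k K : ℕ} (Vk : GaugeField (F.P K) k (SU 2)) {α : ℝ}
    (hα : ∀ (c : PBond (F.P K) (k + 1)) (i : Idx (F.P K)), dist1 (loopHol Vk c i) ≤ α) (c : PBond (F.P K) (k + 1)) (i : Idx (F.P K)) :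
    ‖loopM (coeField Vk) c i - 1‖ ≤ α := by
  rw [← coe_loopHol, ← FederbushMean.dist1_SU_eq]; exact hα c i

/-- `L^{1−d} ≤ 1`. [folklore] -/
theorem inv_pow_le_one_T4 (K : ℕ) : (((F.P K).L : ℝ) ^ ((F.P K).d - 1))⁻¹ ≤ 1 := by
  have hL : (1 : ℝ) ≤ (F.P K).L := by exact_mod_cast (F.P K).hL.2.le
  exact inv_le_one_of_one_le₀ (one_le_pow₀ hL)

/-- `157α < L^{1−d}` forces `α ≤ 1∕50` (indeed `α < 1∕157`). [folklore] -/
theorem alpha_le_fiftieth_of_lt (K : ℕ) {α : ℝ} (hαL : 157 * α < (((F.P K).L : ℝ) ^ ((F.P K).d - 1))⁻¹) : α ≤ 1 / 50 := by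
  have := inv_pow_le_one_T4 F K; linarith

/-- The (0.4) guard from the `α`-currency (`α ≤ 1∕50 < 1∕3 ≤ δ₂`). [cite: Balaban1987RG1, (0.4) p.253] -/
theorem small_of_dist1_le {k K : ℕ} (Vk : GaugeField (F.P K) k (SU 2)) {α : ℝ}
    (hα : ∀ (c : PBond (F.P K) (k + 1)) (i : Idx (F.P K)), dist1 (loopHol Vk c i) ≤ α) (hα50 : α ≤ 1 / 50) (c : PBond (F.P K) (k + 1)) :
    Small expMeanLogSU Vk c := by
  have h3 : (1 : ℝ) / 3 ≤ deltaSU (Fin 2) := by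
    unfold ExpMeanLog.deltaSU
    rw [Fintype.card_fin]
    exact le_min le_rfl (by push_cast; linarith [Real.pi_gt_three])
  exact fun i => lt_of_le_of_lt (hα c i) (lt_of_lt_of_le (by linarith) h3)

/-! ## §2  ★★★ `D̃` on the k-uniform ball -/

/-- ★★★ **`D̃` AT THE RECORD ON A k-UNIFORM BALL.**  With `θ = L^{1−d} − 157α > 0`, `b = 6∕θ` ((o1-δ)), `R = 1∕(10⁸dL)`, `C₂ = 2∕R²` ((o1-β)₂) and `ρ₀ = min (R∕3) (1∕(18C₂(b+1)))`: `0 < ρ₀` and there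
is `D̃ : (FluctIdx → ℂ) → (coarse matrix fields)` with `D̃(B) ∈ closedBall 0 (4C₂ρ₀²)` and `C̃_ℂ(B − h_ℂ D̃(B)) = D̃(B)` for all `‖B‖ < ρ₀` — print's «there exists exactly one solution …
an analytic function of B» with constants depending on `d, L, α` ONLY. [cite: Balaban1987RG1, p.267; Balaban1985Variational, (96)–(98) p.292] -/
theorem exists_recordDt_uniform (k K : ℕ) (hk : k + 1 ≤ (F.P K).m + (F.P K).K) (Vk : GaugeField (F.P K) k (SU 2)) {α : ℝ}
    (hα : ∀ (c : PBond (F.P K) (k + 1)) (i : Idx (F.P K)), dist1 (loopHol Vk c i) ≤ α) (hαL : 157 * α < (((F.P K).L : ℝ) ^ ((F.P K).d - 1))⁻¹) :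
    0 < min ((1 : ℝ) / (10 ^ 8 * (F.P K).d * (F.P K).L) / 3)
        (1 / (18 * (2 * 1 / (1 / (10 ^ 8 * (F.P K).d * (F.P K).L)) ^ 2) * (6 / ((((F.P K).L : ℝ) ^ ((F.P K).d - 1))⁻¹ - 157 * α) + 1))) ∧
    ∃ Dt : (FluctIdx F k K → ℂ) → (PBond (F.P K) (k + 1) → MatA 2), ∀ B : FluctIdx F k K → ℂ,
      ‖B‖ < min ((1 : ℝ) / (10 ^ 8 * (F.P K).d * (F.P K).L) / 3)
          (1 / (18 * (2 * 1 / (1 / (10 ^ 8 * (F.P K).d * (F.P K).L)) ^ 2) * (6 / ((((F.P K).L : ℝ) ^ ((F.P K).d - 1))⁻¹ - 157 * α) + 1))) →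
      Dt B ∈ closedBall (0 : PBond (F.P K) (k + 1) → MatA 2) (4 * (2 * 1 / (1 / (10 ^ 8 * (F.P K).d * (F.P K).L)) ^ 2) *
          min ((1 : ℝ) / (10 ^ 8 * (F.P K).d * (F.P K).L) / 3)
            (1 / (18 * (2 * 1 / (1 / (10 ^ 8 * (F.P K).d * (F.P K).L)) ^ 2) * (6 / ((((F.P K).L : ℝ) ^ ((F.P K).d - 1))⁻¹ - 157 * α) + 1))) ^ 2) ∧
        recordCtC F k K Vk (B - hopLinGraphC F k K Vk (Dt B)) = Dt B := by
  have hα50 : α ≤ 1 / 50 := alpha_le_fiftieth_of_lt F K hαL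
  have hα24 : α ≤ 1 / 24 := hα50.trans (by norm_num)
  have hθ : 0 < (((F.P K).L : ℝ) ^ ((F.P K).d - 1))⁻¹ - 157 * α := sub_pos.2 hαL
  have hb : (0 : ℝ) ≤ 6 / ((((F.P K).L : ℝ) ^ ((F.P K).d - 1))⁻¹ - 157 * α) := by positivity
  exact exists_recordDt₀ F k K hk Vk (norm_loopM_sub_one_le_of_dist1 F Vk hα) hα50 (small_of_dist1_le F Vk hα hα50) hb
    (norm_hopLinGraphC_le F k K hk Vk hα hα24 hαL)

/-! ## §3  The linearisation on the k-uniform ball -/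

/-- ★★ **THE LINEARISATION ON THE k-UNIFORM BALL**: for every `D̃` solving the fixed-point equation in the closed ball `4C₂ρ₀²` on `‖B‖ < ρ₀` (e.g. the one of §2), `Q̃_ℂ(B − h_ℂD̃(B)) = LQ̃_ℂ B` for
`‖B‖ < ρ₀` — print p.267 «LQ̃B′ + C̃(B′) = LQ̃B», the `b₀`-letter supplied by ✓`recordB0BlockInvertible_of_loopSmall`. [cite: Balaban1987RG1, p.267 (displayed equation)] -/
theorem recordQtC_sub_hop_recordDt_uniform (k K : ℕ) (hk : k + 1 ≤ (F.P K).m + (F.P K).K) (Vk : GaugeField (F.P K) k (SU 2)) {α : ℝ}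
    (hα : ∀ (c : PBond (F.P K) (k + 1)) (i : Idx (F.P K)), dist1 (loopHol Vk c i) ≤ α) (hαL : 157 * α < (((F.P K).L : ℝ) ^ ((F.P K).d - 1))⁻¹)
    {Dt : (FluctIdx F k K → ℂ) → (PBond (F.P K) (k + 1) → MatA 2)}
    (hball : ∀ B, ‖B‖ < min ((1 : ℝ) / (10 ^ 8 * (F.P K).d * (F.P K).L) / 3)
          (1 / (18 * (2 * 1 / (1 / (10 ^ 8 * (F.P K).d * (F.P K).L)) ^ 2) * (6 / ((((F.P K).L : ℝ) ^ ((F.P K).d - 1))⁻¹ - 157 * α) + 1))) →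
      Dt B ∈ closedBall (0 : PBond (F.P K) (k + 1) → MatA 2) (4 * (2 * 1 / (1 / (10 ^ 8 * (F.P K).d * (F.P K).L)) ^ 2) *
          min ((1 : ℝ) / (10 ^ 8 * (F.P K).d * (F.P K).L) / 3)
            (1 / (18 * (2 * 1 / (1 / (10 ^ 8 * (F.P K).d * (F.P K).L)) ^ 2) * (6 / ((((F.P K).L : ℝ) ^ ((F.P K).d - 1))⁻¹ - 157 * α) + 1))) ^ 2))
    (hfix : ∀ B, ‖B‖ < min ((1 : ℝ) / (10 ^ 8 * (F.P K).d * (F.P K).L) / 3)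
          (1 / (18 * (2 * 1 / (1 / (10 ^ 8 * (F.P K).d * (F.P K).L)) ^ 2) * (6 / ((((F.P K).L : ℝ) ^ ((F.P K).d - 1))⁻¹ - 157 * α) + 1))) →
      recordCtC F k K Vk (B - hopLinGraphC F k K Vk (Dt B)) = Dt B)
    {B : FluctIdx F k K → ℂ}
    (hB : ‖B‖ < min ((1 : ℝ) / (10 ^ 8 * (F.P K).d * (F.P K).L) / 3)
          (1 / (18 * (2 * 1 / (1 / (10 ^ 8 * (F.P K).d * (F.P K).L)) ^ 2) * (6 / ((((F.P K).L : ℝ) ^ ((F.P K).d - 1))⁻¹ - 157 * α) + 1)))) :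
    recordQtC F k K Vk (B - hopLinGraphC F k K Vk (Dt B)) = recordLQtC F k K Vk B := by
  have hα50 : α ≤ 1 / 50 := alpha_le_fiftieth_of_lt F K hαL
  have hα24 : α ≤ 1 / 24 := hα50.trans (by norm_num)
  have hθ : 0 < (((F.P K).L : ℝ) ^ ((F.P K).d - 1))⁻¹ - 157 * α := sub_pos.2 hαL
  have hb : (0 : ℝ) ≤ 6 / ((((F.P K).L : ℝ) ^ ((F.P K).d - 1))⁻¹ - 157 * α) := by positivity
  have hd : (1 : ℝ) ≤ (F.P K).d := by exact_mod_cast (F.P K).hd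
  have hL : (1 : ℝ) ≤ (F.P K).L := by exact_mod_cast (F.P K).hL.2.le
  have hR : (0 : ℝ) < 1 / (10 ^ 8 * (F.P K).d * (F.P K).L) := by positivity
  have hC₂ : (0 : ℝ) < 2 * 1 / (1 / (10 ^ 8 * (F.P K).d * (F.P K).L)) ^ 2 := by positivity
  obtain ⟨_, hq, h3⟩ := recordDt_smallness_of_radius hR hC₂ hb
  exact recordQtC_sub_hop_recordDt F k K hk Vk (norm_loopM_sub_one_le_of_dist1 F Vk hα) hα50 (small_of_dist1_le F Vk hα hα50)
    (recordB0BlockInvertible_of_loopSmall F k K hk Vk hα hα24 hαL) hb (norm_hopLinGraphC_le F k K hk Vk hα hα24 hαL) hq h3 hball hfix hB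

end Summit.QuantumFields.YangMills.Theorems.BalabanUVNodesPortS1

end
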